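import Summits.BirchSwinnertonDyer.Rank1Residual.GaloisImage.LocalH1TorsionBounded
import Summits.BirchSwinnertonDyer.Rank1Residual.Additive.KummerVersusUnramifiedLocal
import HarnessLib

/-!
# `#H¹(K_v, E[p]) = (#H¹_ur(K_v, E[p]))²` at EVERY finite place `v ∤ p` — `E[p]` ramified at `v` or
# not — the count binder `hcardΛ` of the N2 parity-law instance, discharged (cell `b2b-bsdres`,
# team n1011, row T-HCARD; seat n1011-p05 GEN 16, ★ R5-280 (b); TOOL, theorems only: no definition,
# no named fact, no `sorry`; nothing booked)

HONEST FRAMING (cell `b2b-bsdres`, run/shared/lean/b2b/bsd-rank1-residual/, verbatim in every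
file): the goal of the cell is to DELETE the COMBINATION-SHAPED residual classes of the
Birch–Swinnerton-Dyer formula for ALL analytic-rank `≤ 1` elliptic curves over `ℚ` — "full BSD
formula for every rank `≤ 1` curve in class `C`" assembled STRICTLY from published theorems — so
that the rank-`≤ 1` remainder becomes exactly the CONSTRUCTION-SHAPED classes, which are TYPED
(missing-input `Prop`s), NOT attempted. This is not "finishing BSD". T-HCARD is a TOOL count: it
closes NO class and NO pair; the N2 (= X10b) records that feed it to `hcardΛ` stay EVIDENCE under
their displayed binders; N2 stays CONSTRUCTION-SHAPED / NEEDS `X_A3`; no mark / label / tier / count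
moves.

## What and why

The N2 class lead's PART IV `X10/ResidualSelmerUnramifiedDuality.lean` (`hΛ_groupForm`,
`hΛ_groupForm_of_forall`: "`H¹_ur(K_v, E[p])` is its own annihilator under `inv_v(· ∪_e ·)`",
Klagsbrun–Mazur–Rubin 2013 Thm. 3.1 (ii) / Milne *ADT* I Thm. 2.6) keeps ONE displayed count binder

  `hcardΛ : #H¹(K_v, E[p]) ≤ #H¹_ur(K_v, E[p]) · #H¹_ur(K_v, E[p])`     (finite `v ∉ S₀ ⊇ {v ∣ p}`),

and its PART VII types it only modulo `GaloisRep.IsUnramifiedAt v (E[p])`.  No unramifiedness is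
needed: Milne I Thm. 2.8 / Lemma 2.9 count, for EVERY finite discrete module `M` at `v ∤ #M`,
`#H¹_ur(K_v, M) = #H⁰(K_v, M)` (`Γ/I ≅ Ẑ` procyclic: `h¹ = h⁰` on the finite module `M^{I}`, and
`(M^{I})^{Γ/I} = M^{Γ}`) and `#H¹(K_v, M) = #H⁰(K_v, M) · #H²(K_v, M)`; for `M = E[p]`, self-dual under
the Weil pairing, `#H² = #H⁰ = #E(K_v)[p]`.  Both halves are tree theorems:

* (a) this lineage's `GaloisImage.LocalH1TorsionBounded` §2 (Tate's prime-to-`p` Euler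
  characteristic `natCard_invariants_mul_natCard_two_eq` + `natCard_invariants_torsion_restrictField`
  + `natCard_galoisCohomology_two_torsion_restrictField`), stated there at level `p^{m+1}`; §1 below
  RE-RUNS that proof at `n = p` (so that no transport along `p ^ (0+1) = p` inside the coefficient
  type is needed): `#H¹(K_v, E[p]) = #E(K_v)[p]²`, UNCONDITIONAL at `v ∤ p`;
* (b) n1011-p16's `WeierstrassCurve.natCard_unramifiedSubgroup_torsion_eq_natCard_ker_nsmul`
  (`Additive/KummerVersusUnramifiedLocal.lean`): `#H¹_ur(K_v, E[p]) = #E(K_v)[p]` at EVERY finite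
  place, any reduction type, via n1011-p06's ramification-free count
  `Additive.natCard_unramifiedSubgroup_eq_natCard_invariants_general` (`#H¹_ur(F, A) = #A^{Γ_F}`).

Assembled here, in the N2 lead's spelling (`DiscreteGaloisModule.toLocal ρ (Sum.inr v)` and
`GaloisRep.toLocal v ρ` are both `GaloisRep.restrictField (v.adicCompletion K) ρ` by `rfl`):

* §1 `natCard_galoisCohomology_one_primeTorsion_adicCompletion_eq_sq_of_not_mem` —
  `#H¹(K_v, E[p]) = #E(K_v)[p]²` (`restrictField` spelling, any universe);
  `natCard_unramifiedSubgroup_torsion_adicCompletion_eq_of_ne_zero` — `#H¹_ur(K_v, E[n]) = #E(K_v)[n]`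
  for every `n ≠ 0` (the prime-power-ready form of (b), same two-line proof);
* §2 **`natCard_galoisCohomology_one_toLocal_eq_natCard_unramifiedSubgroup_sq`** —
  `#H¹(K_v, E[p]) = (#H¹_ur(K_v, E[p]))²` for `W` elliptic over a number field `K`, `p` prime, every
  finite `v` with `(p : 𝓞 K) ∉ v.asIdeal`, NO reduction / unramifiedness hypothesis; the product form
  `…_eq_natCard_unramifiedSubgroup_mul`; the inequality `…_le_natCard_unramifiedSubgroup_mul`
  (= `hcardΛ` of `hΛ_groupForm` at one place); and **`hcardΛ_of_forall_mem`** — the binder of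
  `hΛ_groupForm_of_forall` VERBATIM (`∀ v, (Sum.inr v : Place K) ∉ S₀ → #H¹ ≤ #H¹_ur · #H¹_ur`) from
  `∀ v, (p : 𝓞 K) ∈ v.asIdeal → (Sum.inr v : Place K) ∈ S₀`;
* §3 the prime-power twin `natCard_galoisCohomology_one_toLocal_primePow_eq_natCard_unramifiedSubgroup_sq`
  — `#H¹(K_v, E[p^{m+1}]) = (#H¹_ur(K_v, E[p^{m+1}]))²` at `v ∤ p` ((a) by name + §1's count).

(The hypothesis `v ∤ p` cannot be dropped: at `v ∣ p`, `#H¹(K_v, E[p]) = #E(K_v)[p]² · p^{2[K_v:ℚ_p]}`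
exceeds `(#H¹_ur)² = #E(K_v)[p]²`.)

References: J. S. Milne, *Arithmetic Duality Theorems* (2006) I Thm. 2.8, Lemma 2.9, Cor. 2.3,
Lemma 3.3 [MilneADT2006]; K. Rubin, *Euler systems and Kolyvagin systems* (PCMI 18, 2011)
Prop. 1.4.13 [Rubin2011]; Z. Klagsbrun, B. Mazur, K. Rubin, Ann. of Math. 178 (2013) Thm. 3.1 (ii)
[KlagsbrunMazurRubin2013]; J. H. Silverman, *AEC* III.8 [SilvermanAEC2009].
-/

set_option autoImplicit false

noncomputable section

open scoped Classical NumberField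

universe u

namespace Summit.BirchSwinnertonDyer.Rank1Residual.GaloisImage.LocalH1UnramifiedSquare

open Field ValuativeRel NumberField IsDedekindDomain WeierstrassCurve
open Literature.NumberTheory.EllipticCurves Literature.NumberTheory.GaloisRepresentations
open Literature.NumberTheory.GaloisRepresentations.DiscreteGaloisModule (unramifiedSubgroup)
open scoped ContRepresentation

/-! ## §1. `#H¹(K_v, E[p]) = #E(K_v)[p]²` and `#H¹_ur(K_v, E[n]) = #E(K_v)[n]` (`restrictField` spelling) -/

section RestrictField

variable {K : Type u} [Field K] [NumberField K] (W : WeierstrassCurve K) [W.IsElliptic]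
variable (v : HeightOneSpectrum (𝓞 K)) (p : ℕ) [hp : Fact p.Prime]

/-- **`#H¹(K_v, E[p]) = #E(K_v)[p]²` at a finite place `v ∤ p`, UNCONDITIONALLY** (no reduction or
unramifiedness hypothesis): Tate's local Euler–Poincaré characteristic for the `p`-primary module
`E[p]` at residue characteristic `≠ p` (tree `natCard_invariants_mul_natCard_two_eq`:
`#M^{Γ} · #H² = #H¹`) with `#H⁰ = #H² = #E(K_v)[p]` (`natCard_invariants_torsion_restrictField`,
`natCard_galoisCohomology_two_torsion_restrictField` — bidegree-`(2,0)` duality + Weil pairing).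
The proof of `natCard_galoisCohomology_one_torsion_adicCompletion_eq_sq_of_not_mem` (level
`p^{m+1}`) re-run at `n = p`.  Milne I Thm. 2.8 for `M = E[p]`, `v ∤ p`.
[cite: MilneADT2006, Ch. I §2, Thm. 2.8 (p. 31)] [cite: SilvermanAEC2009, Prop. III.8.1] -/
theorem natCard_galoisCohomology_one_primeTorsion_adicCompletion_eq_sq_of_not_mem
    (hpv : ((p : ℕ) : 𝓞 K) ∉ v.asIdeal) :
    Nat.card (galoisCohomology
        (GaloisRep.restrictField (v.adicCompletion K) (W.torsionGaloisModule (p : ℕ))) 1) =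
      Nat.card (nsmulAddMonoidHom p :
          (W.baseChange (v.adicCompletion K)).toAffine.Point →+ _).ker ^ 2 := by
  haveI : CharZero (v.adicCompletion K) := charZero_adicCompletion v
  haveI : NeZero p := ⟨hp.out.ne_zero⟩
  -- `H²` needs `LocallyCompactSpace Γ_{K_v}` (inside this proof only) and the finiteness of `E[p]`
  haveI := absoluteGaloisGroup_compactSpace (v.adicCompletion K)
  haveI : Finite (geomTorsion W ((p : ℕ) : ℤ)) := finite_geomTorsion_of_neZero W p
  have hℓ : p ≠ ringChar 𝓀[v.adicCompletion K] :=
    ringChar_residueField_adicCompletion_ne_of_not_mem v p hpv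
  set F := v.adicCompletion K with hF
  set ρ : ContinuousRep (absoluteGaloisGroup F) ℤ (geomTorsion W (p : ℕ)) :=
    GaloisRep.restrictField F (W.torsionGaloisModule (p : ℕ)) with hρ
  -- `E[p]` is `p`-primary
  have hA : IsPrimaryTorsion p (geomTorsion W ((p : ℕ) : ℤ)) :=
    IsPrimaryTorsion.of_forall_nsmul_eq_zero (r := 1) fun T => by
      rw [pow_one]
      exact AddSubgroup.torsionBy.nsmul T
  obtain ⟨-, hEq⟩ := natCard_invariants_mul_natCard_two_eq F ρ hA hℓ
  -- `#H⁰` and `#H²`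
  have h0 : Nat.card ρ.toTopRep.ρ.invariants =
      Nat.card (nsmulAddMonoidHom p : (W.baseChange F).toAffine.Point →+ _).ker :=
    natCard_invariants_torsion_restrictField W F (NeZero.ne _)
  have h2 : Nat.card (continuousCohomology 2 ρ.toTopRep) =
      Nat.card (nsmulAddMonoidHom p : (W.baseChange F).toAffine.Point →+ _).ker :=
    (natCard_galoisCohomology_two_torsion_restrictField W F p hp.out.isPrimePow).2
  change Nat.card (continuousCohomology 1 ρ.toTopRep) = _
  rw [← hEq, h0, h2, sq]

omit hp in
/-- **`#H¹_ur(K_v, E[n]) = #E(K_v)[n]`** at every finite place `v`, every `n ≠ 0` (any reduction type,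
any residue characteristic): n1011-p06's ramification-free count `#H¹_ur(F, A) = #A^{Γ_F}`
(`Additive.natCard_unramifiedSubgroup_eq_natCard_invariants_general`) with
`#(E[n]|_{Γ_{K_v}})^{Γ_{K_v}} = #E(K_v)[n]` (`natCard_invariants_torsion_restrictField`); the case
`n = p` is n1011-p16's `WeierstrassCurve.natCard_unramifiedSubgroup_torsion_eq_natCard_ker_nsmul`.
Milne I Lemma 2.9 + Lemma 3.3; Rubin PCMI Prop. 1.4.13 (1).
[cite: MilneADT2006, Ch. I, Lemma 2.9 and Lemma 3.3] [cite: Rubin2011, Prop. 1.4.13 (1) (p. 9)] -/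
theorem natCard_unramifiedSubgroup_torsion_adicCompletion_eq_of_ne_zero {n : ℕ} (hn : n ≠ 0) :
    Nat.card (unramifiedSubgroup
        (GaloisRep.restrictField (v.adicCompletion K) (W.torsionGaloisModule (n : ℕ))) 1) =
      Nat.card (nsmulAddMonoidHom n :
          (W.baseChange (v.adicCompletion K)).toAffine.Point →+ _).ker := by
  haveI : CharZero (v.adicCompletion K) := charZero_adicCompletion v
  haveI : NeZero n := ⟨hn⟩
  haveI : Finite (geomTorsion W ((n : ℕ) : ℤ)) := finite_geomTorsion_of_neZero W n
  rw [Summit.BirchSwinnertonDyer.Rank1Residual.Additive.natCard_unramifiedSubgroup_eq_natCard_invariants_general,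
    natCard_invariants_torsion_restrictField W (v.adicCompletion K) hn]

end RestrictField

/-! ## §2. `#H¹(K_v, E[p]) = (#H¹_ur(K_v, E[p]))²` in the N2 lead's spelling, and the binder `hcardΛ` -/

section ToLocal

variable {K : Type} [Field K] [NumberField K] (W : WeierstrassCurve K) [W.IsElliptic] (p : ℕ)
  [hp : Fact p.Prime]

/-- **`#H¹(K_v, E[p]) = (#H¹_ur(K_v, E[p]))²` at EVERY finite place `v ∤ p`** of a number field `K`,
for `W` elliptic and `p` prime — `E[p]` may be RAMIFIED at `v`; no reduction hypothesis.  §1's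
`#H¹ = #E(K_v)[p]²` (Milne I Thm. 2.8) against n1011-p16's `#H¹_ur = #E(K_v)[p]` (Milne I Lemma 2.9,
ramified modules allowed). [cite: MilneADT2006, Ch. I, Thm. 2.8 and Lemma 2.9] -/
theorem natCard_galoisCohomology_one_toLocal_eq_natCard_unramifiedSubgroup_sq
    {v : HeightOneSpectrum (𝓞 K)} (hpv : ((p : ℕ) : 𝓞 K) ∉ v.asIdeal) :
    Nat.card (galoisCohomology ((W.torsionGaloisModule p).toLocal (Sum.inr v)) 1) =
      Nat.card (unramifiedSubgroup (GaloisRep.toLocal v (W.torsionGaloisModule p)) 1) ^ 2 := by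
  change Nat.card (galoisCohomology
      (GaloisRep.restrictField (v.adicCompletion K) (W.torsionGaloisModule (p : ℕ))) 1) =
    Nat.card (unramifiedSubgroup
      (GaloisRep.restrictField (v.adicCompletion K) (W.torsionGaloisModule (p : ℕ))) 1) ^ 2
  rw [natCard_galoisCohomology_one_primeTorsion_adicCompletion_eq_sq_of_not_mem W v p hpv,
    W.natCard_unramifiedSubgroup_torsion_eq_natCard_ker_nsmul v]

/-- Product form: **`#H¹(K_v, E[p]) = #H¹_ur(K_v, E[p]) · #H¹_ur(K_v, E[p])`** at every finite `v ∤ p`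
(ramified `E[p]` allowed). [cite: MilneADT2006, Ch. I, Thm. 2.8 and Lemma 2.9] -/
theorem natCard_galoisCohomology_one_toLocal_eq_natCard_unramifiedSubgroup_mul
    {v : HeightOneSpectrum (𝓞 K)} (hpv : ((p : ℕ) : 𝓞 K) ∉ v.asIdeal) :
    Nat.card (galoisCohomology ((W.torsionGaloisModule p).toLocal (Sum.inr v)) 1) =
      Nat.card (unramifiedSubgroup (GaloisRep.toLocal v (W.torsionGaloisModule p)) 1) *
        Nat.card (unramifiedSubgroup (GaloisRep.toLocal v (W.torsionGaloisModule p)) 1) := by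
  rw [natCard_galoisCohomology_one_toLocal_eq_natCard_unramifiedSubgroup_sq W p hpv, sq]

/-- **`hcardΛ` at one place**: `#H¹(K_v, E[p]) ≤ #H¹_ur(K_v, E[p]) · #H¹_ur(K_v, E[p])` at every finite
`v ∤ p` — the count binder of `X10/ResidualSelmerUnramifiedDuality.hΛ_groupForm`, with NO
unramifiedness hypothesis on `E[p]`. [cite: MilneADT2006, Ch. I, Thm. 2.8 and Lemma 2.9] -/
theorem natCard_galoisCohomology_one_toLocal_le_natCard_unramifiedSubgroup_mul
    {v : HeightOneSpectrum (𝓞 K)} (hpv : ((p : ℕ) : 𝓞 K) ∉ v.asIdeal) :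
    Nat.card (galoisCohomology ((W.torsionGaloisModule p).toLocal (Sum.inr v)) 1) ≤
      Nat.card (unramifiedSubgroup (GaloisRep.toLocal v (W.torsionGaloisModule p)) 1) *
        Nat.card (unramifiedSubgroup (GaloisRep.toLocal v (W.torsionGaloisModule p)) 1) :=
  (natCard_galoisCohomology_one_toLocal_eq_natCard_unramifiedSubgroup_mul W p hpv).le

/-- **`hcardΛ` — the count binder of `X10/ResidualSelmerUnramifiedDuality.hΛ_groupForm_of_forall`,
VERBATIM, discharged**: if the finite set of places `S₀` contains every finite place above `p`, then
at every finite `v ∉ S₀`, `#H¹(K_v, E[p]) ≤ #H¹_ur(K_v, E[p]) · #H¹_ur(K_v, E[p])` — for `E[p]`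
ramified at `v` or not. [cite: MilneADT2006, Ch. I, Thm. 2.8 and Lemma 2.9] -/
theorem hcardΛ_of_forall_mem {S₀ : Finset (Place K)}
    (hS₀ : ∀ v : HeightOneSpectrum (𝓞 K), ((p : ℕ) : 𝓞 K) ∈ v.asIdeal → (Sum.inr v : Place K) ∈ S₀) :
    ∀ v : HeightOneSpectrum (𝓞 K), (Sum.inr v : Place K) ∉ S₀ →
      Nat.card (galoisCohomology ((W.torsionGaloisModule p).toLocal (Sum.inr v)) 1) ≤
        Nat.card (unramifiedSubgroup (GaloisRep.toLocal v (W.torsionGaloisModule p)) 1) *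
          Nat.card (unramifiedSubgroup (GaloisRep.toLocal v (W.torsionGaloisModule p)) 1) :=
  fun v hv =>
    natCard_galoisCohomology_one_toLocal_le_natCard_unramifiedSubgroup_mul W p fun h => hv (hS₀ v h)

/-! ## §3. The prime-power twin `E[p^{m+1}]` -/

/-- **`#H¹(K_v, E[p^{m+1}]) = (#H¹_ur(K_v, E[p^{m+1}]))²` at every finite `v ∤ p`** (ramified
`E[p^{m+1}]` allowed): this lineage's `natCard_galoisCohomology_one_torsion_adicCompletion_eq_sq_of_not_mem`
(`#H¹ = #E(K_v)[p^{m+1}]²`, Milne I Thm. 2.8) against §1's `#H¹_ur(K_v, E[n]) = #E(K_v)[n]`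
(Milne I Lemma 2.9). [cite: MilneADT2006, Ch. I, Thm. 2.8 and Lemma 2.9] -/
theorem natCard_galoisCohomology_one_toLocal_primePow_eq_natCard_unramifiedSubgroup_sq
    {v : HeightOneSpectrum (𝓞 K)} (hpv : ((p : ℕ) : 𝓞 K) ∉ v.asIdeal) (m : ℕ) :
    Nat.card (galoisCohomology ((W.torsionGaloisModule (p ^ (m + 1) : ℕ)).toLocal (Sum.inr v)) 1) =
      Nat.card (unramifiedSubgroup
        (GaloisRep.toLocal v (W.torsionGaloisModule (p ^ (m + 1) : ℕ))) 1) ^ 2 := by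
  change Nat.card (galoisCohomology
      (GaloisRep.restrictField (v.adicCompletion K) (W.torsionGaloisModule (p ^ (m + 1) : ℕ))) 1) =
    Nat.card (unramifiedSubgroup
      (GaloisRep.restrictField (v.adicCompletion K) (W.torsionGaloisModule (p ^ (m + 1) : ℕ))) 1) ^ 2
  rw [natCard_galoisCohomology_one_torsion_adicCompletion_eq_sq_of_not_mem W v p hpv m,
    natCard_unramifiedSubgroup_torsion_adicCompletion_eq_of_ne_zero W v
      (pow_ne_zero (m + 1) hp.out.ne_zero)]

end ToLocal

end Summit.BirchSwinnertonDyer.Rank1Residual.GaloisImage.LocalH1UnramifiedSquare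

end
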